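import Summits.Ventures.GridStability.Models.WSCC9FaultOnTubeLegs

/-!
# WSCC9FaultOnTubeChain — the CHAIN theorem and the SLICE BOXES of the N-leg kernel tube integrator for the WSCC9 bus-7 fault-on motion (part 3)

Venture GRIDFUSION (LADDER-GRIDFUSION G1-cct, «#61⁗»-successor input; seat gridfusion-model-1 g6).  §1 `holds_next` (the restart box at
the end of a leg), `le_startAt`, `chain_sound` (induction along the list: `chainOK K legs`, `K` holds at `a ≥ 0`, `T` inside leg `k` ⇒ the
box `kboxAt K legs k` holds at `start_k` and the re-based tube of leg `k` holds on `[start_k, T]`), packaged for the printed pre-fault point as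
`faultBus7_tube_of_chainOK`.  §2 `SliceBox` / `Leg.sliceBox K sa sb` (the hull formulas `a₂ ≥ (qlo₂ − qhi₁) + (wlo₂ − whi₁) sa + (L₂ − H₁) sa²/2`,
…, `ω_j ∈ [wlo_j + L_j sa, whi_j + H_j sb]`), the sign test `Leg.sliceOK`, `mem_sliceBox`, and `faultBus7_clearingState_of_chainOK`: the
CLEARING STATE at any `T` with `T − start_k ∈ [sa, sb]` lies in the explicit rational slice box — the «K ⊂ S» consumer's object (sos-1
certificates / sos-3 typing; same shape as `Bench.WSCC9.KBox.rsliceOK`).  Data: `WSCC9FaultOnTubeLegs36` (36 legs of `1/200 s` to `9/50 s`).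
THREE COLUMNS: CERTIFIED = tube/hull sentences for MODEL M′ (classical WSCC9, MV-2 + MV-P + MV-SPD + MV-h12, bolted fault at bus 7, printed
pre-fault point at synchronous speed); VALIDATED = RK4 arc / model-4 tubes; no stability claim.
[cite: Moore1979, §8.1 eqs. (8.5), (8.10) and the step-by-step continuation after (8.5); AndersonFouad1977, Example 2.6 / §2.10]
-/

noncomputable section

open Real Set Finset

namespace Summit.Ventures.GridStability.Models

namespace WSCC9

namespace FaultOnLeg

/-! ### §1 The chain -/

/-- **Restart box at the end of a leg.** Under the hypotheses of `leg_step` with the full step inside the horizon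
(`a + τ ≤ T`), the box `d.next K` holds at `a + τ`. -/
theorem holds_next {d : Leg} {K : KBox6} (hf : d.fieldOK = true) (hi : d.inclOK K = true) {a T : ℝ}
    (ha : 0 ≤ a) (haT : a + (d.τ : ℝ) ≤ T) {Y : ℝ → ClassicalSwing.State 3}
    (hY : faultBus7Printed.IsSolutionOn Y (Icc 0 T)) (hK : Y a ∈ K.toSet ((Y 0).1 0)) :
    Y (a + (d.τ : ℝ)) ∈ (d.next K).toSet ((Y 0).1 0) := by
  have hτ : (0 : ℝ) < (d.τ : ℝ) := by
    simp only [Leg.inclOK, Bool.and_eq_true, decide_eq_true_eq] at hi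
    exact_mod_cast hi.1
  have hY' : faultBus7Printed.IsSolutionOn Y (Icc 0 (a + (d.τ : ℝ))) := fun t ht =>
    (hY t ⟨ht.1, ht.2.trans haT⟩).mono (Icc_subset_Icc_right haT)
  have h := leg_step hf hi ha (by linarith) (by linarith) hY' hK (a + (d.τ : ℝ)) ⟨by linarith, le_rfl⟩
  rw [Leg.mem_tubeSet] at h
  rw [KBox6.mem_toSet] at hK ⊢
  intro i
  obtain ⟨k1, k2, k3, k4⟩ := hK i
  obtain ⟨t1, t2, t3, t4⟩ := h i
  simp only [add_sub_cancel_left] at t1 t2 t3 t4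
  have p1 := mul_le_mul_of_nonneg_right k3 hτ.le
  have p2 := mul_le_mul_of_nonneg_right k4 hτ.le
  simp only [Leg.next]
  push_cast
  refine ⟨by linarith, by linarith, by linarith, by linarith⟩

/-- Start times do not decrease along a checked chain (every leg has `τ > 0`). -/
theorem le_startAt : ∀ (ds : List Leg) (K : KBox6) (a : ℚ) (k : ℕ), chainOK K ds = true → a ≤ startAt a ds k
  | [], _, _, 0, _ => le_rfl
  | [], _, _, _ + 1, _ => le_rfl
  | _ :: _, _, _, 0, _ => le_rfl
  | d :: ds, K, a, k + 1, hc => by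
    simp only [chainOK, Bool.and_eq_true] at hc
    obtain ⟨⟨_, hi⟩, hc'⟩ := hc
    have hτ : 0 < d.τ := by
      simp only [Leg.inclOK, Bool.and_eq_true, decide_eq_true_eq] at hi
      exact hi.1
    have ih := le_startAt ds (d.next K) (a + d.τ) k hc'
    simp only [startAt]
    linarith

/-- **CHAIN SOUNDNESS.** `chainOK K legs`, `K` holds at `a ≥ 0`, a solution on `[0, T]` with `T` inside leg `k`
(`start_k ≤ T ≤ start_k + τ_k`) ⇒ the box `kboxAt K legs k` holds at `start_k` and the tube of leg `k` holds on `[start_k, T]`. -/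
theorem chain_sound : ∀ (legs : List Leg) (K : KBox6) (a : ℚ), 0 ≤ a → chainOK K legs = true →
    ∀ (k : ℕ) (d : Leg), legs[k]? = some d → ∀ (T : ℝ) (Y : ℝ → ClassicalSwing.State 3),
      faultBus7Printed.IsSolutionOn Y (Icc 0 T) → Y (a : ℝ) ∈ K.toSet ((Y 0).1 0) →
      ((startAt a legs k : ℚ) : ℝ) ≤ T → T - ((startAt a legs k : ℚ) : ℝ) ≤ (d.τ : ℝ) →
      Y ((startAt a legs k : ℚ) : ℝ) ∈ (kboxAt K legs k).toSet ((Y 0).1 0) ∧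
        ∀ t ∈ Icc ((startAt a legs k : ℚ) : ℝ) T,
          Y t ∈ d.tubeSet (Y ((startAt a legs k : ℚ) : ℝ)) (t - ((startAt a legs k : ℚ) : ℝ))
  | [], _, _, _, _, k, d, hk => by simp at hk
  | d₀ :: ds, K, a, ha, hc, 0, d, hk => by
    intro T Y hY hK h1 h2
    simp only [List.getElem?_cons_zero, Option.some.injEq] at hk
    subst hk
    simp only [chainOK, Bool.and_eq_true] at hc
    obtain ⟨⟨hf, hi⟩, -⟩ := hc
    simp only [kboxAt, startAt] at h1 h2 ⊢
    exact ⟨hK, leg_step hf hi (by exact_mod_cast ha) h1 h2 hY hK⟩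
  | d₀ :: ds, K, a, ha, hc, k + 1, d, hk => by
    intro T Y hY hK h1 h2
    simp only [List.getElem?_cons_succ] at hk
    simp only [chainOK, Bool.and_eq_true] at hc
    obtain ⟨⟨hf, hi⟩, hc'⟩ := hc
    simp only [kboxAt, startAt] at h1 h2 ⊢
    have hτ : 0 < d₀.τ := by
      simp only [Leg.inclOK, Bool.and_eq_true, decide_eq_true_eq] at hi
      exact hi.1
    have ha' : 0 ≤ a + d₀.τ := by linarith
    have hle : a + d₀.τ ≤ startAt (a + d₀.τ) ds k := le_startAt ds (d₀.next K) (a + d₀.τ) k hc'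
    have hle' : (((a + d₀.τ : ℚ)) : ℝ) ≤ T := le_trans (by exact_mod_cast hle) h1
    have hK' : Y (((a + d₀.τ : ℚ)) : ℝ) ∈ (d₀.next K).toSet ((Y 0).1 0) := by
      push_cast
      exact holds_next hf hi (by exact_mod_cast ha) (by push_cast at hle'; exact hle') hY hK
    exact chain_sound ds (d₀.next K) (a + d₀.τ) ha' hc' k d hk T Y hY hK' h1 h2

/-- `legAt` agrees with list indexing inside the list. -/
theorem getElem?_eq_legAt {legs : List Leg} {k : ℕ} (hk : k < legs.length) : legs[k]? = some (legAt legs k) := by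
  simp only [legAt, List.getD_eq_getElem?_getD, List.getElem?_eq_getElem hk, Option.getD_some]

/-- **THE FAULT-ON TUBE OF A CHECKED CHAIN (printed frame, bus 7 grounded).** `chainOK K₀ legs`, `k < |legs|`, a clearing
time `T` inside leg `k`, a solution `Y` of `faultBus7Printed` on `[0, T]` from the printed pre-fault point at synchronous speed ⇒
the box `kboxAt K₀ legs k` holds at `start_k` and the tube of leg `k` (bounds `[L_k, H_k]`) holds on `[start_k, T]`.
MODELLED: classical WSCC9 fault-on model M′. [cite: Moore1979, §8.1 (step-by-step continuation after (8.5)), eq. (8.10)] -/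
theorem faultBus7_tube_of_chainOK {legs : List Leg} (hc : chainOK K0 legs = true) {k : ℕ} (hk : k < legs.length)
    {T : ℝ} (hT1 : ((startAt 0 legs k : ℚ) : ℝ) ≤ T) (hT2 : T - ((startAt 0 legs k : ℚ) : ℝ) ≤ ((legAt legs k).τ : ℝ))
    {Y : ℝ → ClassicalSwing.State 3} (hY : faultBus7Printed.IsSolutionOn Y (Icc 0 T)) (hω0 : (Y 0).2 = 0)
    (ha2 : (Y 0).1 1 - (Y 0).1 0 ∈ a2Window) (ha3 : (Y 0).1 2 - (Y 0).1 0 ∈ a3Window) :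
    Y ((startAt 0 legs k : ℚ) : ℝ) ∈ (kboxAt K0 legs k).toSet ((Y 0).1 0) ∧
      ∀ t ∈ Icc ((startAt 0 legs k : ℚ) : ℝ) T,
        Y t ∈ (legAt legs k).tubeSet (Y ((startAt 0 legs k : ℚ) : ℝ)) (t - ((startAt 0 legs k : ℚ) : ℝ)) := by
  have h0 : Y ((0 : ℚ) : ℝ) ∈ K0.toSet ((Y 0).1 0) := by push_cast; exact K0_holds hω0 ha2 ha3
  exact chain_sound legs K0 0 le_rfl hc k (legAt legs k) (getElem?_eq_legAt hk) T Y hY h0 hT1 hT2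
/-! ### §2 Slice boxes for the «K ⊂ S» consumer -/

/-- A box for the CLEARING STATE: relative angles `a₂ = δ₂ − δ₁`, `a₃ = δ₃ − δ₁` and the three PRINTED speeds
(the consumer subtracts `ω∞′`). -/
structure SliceBox where
  /-- `a₂` lower -/
  a2lo : ℚ
  /-- `a₂` upper -/
  a2hi : ℚ
  /-- `a₃` lower -/
  a3lo : ℚ
  /-- `a₃` upper -/
  a3hi : ℚ
  /-- printed speeds, lower -/
  wlo : Fin 3 → ℚ
  /-- printed speeds, upper -/
  whi : Fin 3 → ℚ

/-- Two slice boxes with the same corners are equal (used to spell computed boxes out as literals). -/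
theorem SliceBox.eq_of_forall {S S' : SliceBox} (h1 : S.a2lo = S'.a2lo) (h2 : S.a2hi = S'.a2hi) (h3 : S.a3lo = S'.a3lo)
    (h4 : S.a3hi = S'.a3hi) (h5 : ∀ j, S.wlo j = S'.wlo j ∧ S.whi j = S'.whi j) : S = S' := by
  obtain ⟨a, b, c, d, e, f⟩ := S
  obtain ⟨a', b', c', d', e', f'⟩ := S'
  simp only [SliceBox.mk.injEq]
  exact ⟨h1, h2, h3, h4, funext fun j => (h5 j).1, funext fun j => (h5 j).2⟩

namespace Leg

/-- The SLICE BOX of leg `d` started from `K`, for offsets `s = T − start ∈ [sa, sb]`: the hull formulas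
`a₂ ≥ (qlo₂ − qhi₁) + (wlo₂ − whi₁) sa + (L₂ − H₁) sa²/2`, `a₂ ≤ (qhi₂ − qlo₁) + (whi₂ − wlo₁) sb + (H₂ − L₁) sb²/2` (machines 2 vs 1;
likewise 3 vs 1), `ω_j ∈ [wlo_j + L_j sa, whi_j + H_j sb]`. -/
def sliceBox (d : Leg) (K : KBox6) (sa sb : ℚ) : SliceBox where
  a2lo := (K.qlo 1 - K.qhi 0) + (K.wlo 1 - K.whi 0) * sa + (d.L 1 - d.H 0) * sa ^ 2 / 2
  a2hi := (K.qhi 1 - K.qlo 0) + (K.whi 1 - K.wlo 0) * sb + (d.H 1 - d.L 0) * sb ^ 2 / 2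
  a3lo := (K.qlo 2 - K.qhi 0) + (K.wlo 2 - K.whi 0) * sa + (d.L 2 - d.H 0) * sa ^ 2 / 2
  a3hi := (K.qhi 2 - K.qlo 0) + (K.whi 2 - K.wlo 0) * sb + (d.H 2 - d.L 0) * sb ^ 2 / 2
  wlo j := K.wlo j + d.L j * sa
  whi j := K.whi j + d.H j * sb

/-- SIGN TEST making the hull formulas monotone in `s` (all bracketed rates nonnegative) and `0 ≤ sa ≤ sb ≤ τ`. -/
def sliceOK (d : Leg) (K : KBox6) (sa sb : ℚ) : Bool :=
  decide (0 ≤ sa) && decide (sa ≤ sb) && decide (sb ≤ d.τ) &&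
  decide (0 ≤ K.wlo 1 - K.whi 0) && decide (0 ≤ d.L 1 - d.H 0) &&
  decide (0 ≤ K.whi 1 - K.wlo 0) && decide (0 ≤ d.H 1 - d.L 0) &&
  decide (0 ≤ K.wlo 2 - K.whi 0) && decide (0 ≤ d.L 2 - d.H 0) &&
  decide (0 ≤ K.whi 2 - K.wlo 0) && decide (0 ≤ d.H 2 - d.L 0) &&
  decide (∀ j : Fin 3, 0 ≤ d.L j ∧ 0 ≤ d.H j)

end Leg

/-- The slice box as a SET of states (real form). -/
def SliceBox.toSet (S : SliceBox) : Set (ClassicalSwing.State 3) :=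
  {x | (S.a2lo : ℝ) ≤ x.1 1 - x.1 0 ∧ x.1 1 - x.1 0 ≤ (S.a2hi : ℝ) ∧
    (S.a3lo : ℝ) ≤ x.1 2 - x.1 0 ∧ x.1 2 - x.1 0 ≤ (S.a3hi : ℝ) ∧
      ∀ j : Fin 3, (S.wlo j : ℝ) ≤ x.2 j ∧ x.2 j ≤ (S.whi j : ℝ)}

/-- Unfolding `SliceBox.toSet` membership. -/
theorem SliceBox.mem_toSet (S : SliceBox) (x : ClassicalSwing.State 3) :
    x ∈ S.toSet ↔ (S.a2lo : ℝ) ≤ x.1 1 - x.1 0 ∧ x.1 1 - x.1 0 ≤ (S.a2hi : ℝ) ∧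
      (S.a3lo : ℝ) ≤ x.1 2 - x.1 0 ∧ x.1 2 - x.1 0 ≤ (S.a3hi : ℝ) ∧
        ∀ j : Fin 3, (S.wlo j : ℝ) ≤ x.2 j ∧ x.2 j ≤ (S.whi j : ℝ) :=
  Iff.rfl

/-- **Slice membership.** `d.sliceOK K sa sb`, `K` holds at `a`, the tube of `d` re-based at `a` holds at `T`, and
`T − a ∈ [sa, sb]` ⇒ the state `Y T` lies in `d.sliceBox K sa sb`. -/
theorem mem_sliceBox {d : Leg} {K : KBox6} {sa sb : ℚ} (h : d.sliceOK K sa sb = true) {a T : ℝ}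
    {Y : ℝ → ClassicalSwing.State 3} (hK : Y a ∈ K.toSet ((Y 0).1 0)) (ht : Y T ∈ d.tubeSet (Y a) (T - a))
    (hsa : (sa : ℝ) ≤ T - a) (hsb : T - a ≤ (sb : ℝ)) : Y T ∈ (d.sliceBox K sa sb).toSet := by
  simp only [Leg.sliceOK, Bool.and_eq_true, decide_eq_true_eq] at h
  rw [KBox6.mem_toSet] at hK
  rw [Leg.mem_tubeSet] at ht
  rw [SliceBox.mem_toSet]
  obtain ⟨⟨⟨⟨⟨⟨⟨⟨⟨⟨⟨hsa0, -⟩, -⟩, r1⟩, r2⟩, r3⟩, r4⟩, r5⟩, r6⟩, r7⟩, r8⟩, rLH⟩ := h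
  have hsa0' : (0 : ℝ) ≤ (sa : ℝ) := by exact_mod_cast hsa0
  have hs0 : 0 ≤ T - a := le_trans hsa0' hsa
  have hqa : (sa : ℝ) ^ 2 ≤ (T - a) ^ 2 := pow_le_pow_left₀ hsa0' hsa 2
  have hqb : (T - a) ^ 2 ≤ (sb : ℝ) ^ 2 := pow_le_pow_left₀ hs0 hsb 2
  obtain ⟨q0l, q0u, w0l, w0u⟩ := hK 0
  obtain ⟨q1l, q1u, w1l, w1u⟩ := hK 1
  obtain ⟨q2l, q2u, w2l, w2u⟩ := hK 2
  obtain ⟨-, -, p0l, p0u⟩ := ht 0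
  obtain ⟨-, -, p1l, p1u⟩ := ht 1
  obtain ⟨-, -, p2l, p2u⟩ := ht 2
  have c1 := (Rat.cast_le (K := ℝ)).2 r1
  have c2 := (Rat.cast_le (K := ℝ)).2 r2
  have c3 := (Rat.cast_le (K := ℝ)).2 r3
  have c4 := (Rat.cast_le (K := ℝ)).2 r4
  have c5 := (Rat.cast_le (K := ℝ)).2 r5
  have c6 := (Rat.cast_le (K := ℝ)).2 r6
  have c7 := (Rat.cast_le (K := ℝ)).2 r7
  have c8 := (Rat.cast_le (K := ℝ)).2 r8
  push_cast at c1 c2 c3 c4 c5 c6 c7 c8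
  -- speed differences times (T − a), then down/up to sa/sb
  have d21l : ((K.wlo 1 : ℝ) - (K.whi 0 : ℝ)) * (T - a) ≤ ((Y a).2 1 - (Y a).2 0) * (T - a) :=
    mul_le_mul_of_nonneg_right (by linarith) hs0
  have d21u : ((Y a).2 1 - (Y a).2 0) * (T - a) ≤ ((K.whi 1 : ℝ) - (K.wlo 0 : ℝ)) * (T - a) :=
    mul_le_mul_of_nonneg_right (by linarith) hs0
  have d31l : ((K.wlo 2 : ℝ) - (K.whi 0 : ℝ)) * (T - a) ≤ ((Y a).2 2 - (Y a).2 0) * (T - a) :=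
    mul_le_mul_of_nonneg_right (by linarith) hs0
  have d31u : ((Y a).2 2 - (Y a).2 0) * (T - a) ≤ ((K.whi 2 : ℝ) - (K.wlo 0 : ℝ)) * (T - a) :=
    mul_le_mul_of_nonneg_right (by linarith) hs0
  have m1 := mul_le_mul_of_nonneg_left hsa c1
  have m2 := mul_le_mul_of_nonneg_left hqa c2
  have m3 := mul_le_mul_of_nonneg_left hsb c3
  have m4 := mul_le_mul_of_nonneg_left hqb c4
  have m5 := mul_le_mul_of_nonneg_left hsa c5
  have m6 := mul_le_mul_of_nonneg_left hqa c6
  have m7 := mul_le_mul_of_nonneg_left hsb c7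
  have m8 := mul_le_mul_of_nonneg_left hqb c8
  refine ⟨?_, ?_, ?_, ?_, fun j => ?_⟩
  · simp only [Leg.sliceBox]; push_cast
    linarith only [q1l, q0u, d21l, m1, m2, p1l, p0u]
  · simp only [Leg.sliceBox]; push_cast
    linarith only [q1u, q0l, d21u, m3, m4, p1u, p0l]
  · simp only [Leg.sliceBox]; push_cast
    linarith only [q2l, q0u, d31l, m5, m6, p2l, p0u]
  · simp only [Leg.sliceBox]; push_cast
    linarith only [q2u, q0l, d31u, m7, m8, p2u, p0l]
  · obtain ⟨hL, hH⟩ := rLH j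
    have hL' : (0 : ℝ) ≤ (d.L j : ℝ) := by exact_mod_cast hL
    have hH' : (0 : ℝ) ≤ (d.H j : ℝ) := by exact_mod_cast hH
    obtain ⟨-, -, wjl, wju⟩ := hK j
    obtain ⟨tj1, tj2, -, -⟩ := ht j
    have p1 := mul_le_mul_of_nonneg_left hsa hL'
    have p2 := mul_le_mul_of_nonneg_left hsb hH'
    simp only [Leg.sliceBox]; push_cast
    exact ⟨by linarith only [wjl, tj1, p1], by linarith only [wju, tj2, p2]⟩

/-- **THE CLEARING STATE OF A CHECKED CHAIN lies in the slice box.** `chainOK K₀ legs`, `k < |legs|`,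
`(legAt legs k).sliceOK (kboxAt K₀ legs k) sa sb`, a clearing time `T` with `T − start_k ∈ [sa, sb]`, and a solution `Y` of
`faultBus7Printed` on `[0, T]` from the printed pre-fault point at synchronous speed ⇒ `Y T ∈ sliceBox` (relative angles
`a₂, a₃` and printed speeds).  This is the «K ⊂ S» consumer's object for clearing times in `[start_k + sa, start_k + sb]`.
MODELLED: classical WSCC9 fault-on model M′. [cite: Moore1979, §8.1 eq. (8.10)] -/
theorem faultBus7_clearingState_of_chainOK {legs : List Leg} (hc : chainOK K0 legs = true) {k : ℕ}
    (hk : k < legs.length) {sa sb : ℚ} (hs : (legAt legs k).sliceOK (kboxAt K0 legs k) sa sb = true)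
    {T : ℝ} (hT1 : ((startAt 0 legs k : ℚ) : ℝ) + sa ≤ T) (hT2 : T ≤ ((startAt 0 legs k : ℚ) : ℝ) + sb)
    {Y : ℝ → ClassicalSwing.State 3} (hY : faultBus7Printed.IsSolutionOn Y (Icc 0 T)) (hω0 : (Y 0).2 = 0)
    (ha2 : (Y 0).1 1 - (Y 0).1 0 ∈ a2Window) (ha3 : (Y 0).1 2 - (Y 0).1 0 ∈ a3Window) :
    Y T ∈ ((legAt legs k).sliceBox (kboxAt K0 legs k) sa sb).toSet := by
  have hs' := hs
  simp only [Leg.sliceOK, Bool.and_eq_true, decide_eq_true_eq] at hs'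
  obtain ⟨⟨⟨⟨⟨⟨⟨⟨⟨⟨⟨hsa0, -⟩, hsbτ⟩, -⟩, -⟩, -⟩, -⟩, -⟩, -⟩, -⟩, -⟩, -⟩ := hs'
  have hsa0' : (0 : ℝ) ≤ (sa : ℝ) := by exact_mod_cast hsa0
  have hsbτ' : ((sb : ℚ) : ℝ) ≤ ((legAt legs k).τ : ℝ) := by exact_mod_cast hsbτ
  have hT1' : ((startAt 0 legs k : ℚ) : ℝ) ≤ T := by linarith
  have hT2' : T - ((startAt 0 legs k : ℚ) : ℝ) ≤ ((legAt legs k).τ : ℝ) := by linarith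
  obtain ⟨hK, htube⟩ := faultBus7_tube_of_chainOK hc hk hT1' hT2' hY hω0 ha2 ha3
  exact mem_sliceBox hs hK (htube T ⟨hT1', le_rfl⟩) (by linarith) (by linarith)
end FaultOnLeg

end WSCC9

end Summit.Ventures.GridStability.Models

end
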